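import Mathlib
import HarnessLib

/-!
# `NoHeavyLowerTail` (crux stmt-CriticalPhenomena-4575), antipodal-Kleitman programme: the HALF-CONE DICTIONARY — an AK poset with a half
# satisfies property A of its upper half (bridge between `antipodalKleitman_prod`-style hypotheses and `AntitheticRowPairing.matchable_product`)

Support file (seat `prim-ineq-gen-7` gen 49; `--supports stmt-CriticalPhenomena-4575`, closed crux).  No `sorry`, no definitions; standard axioms.
Memo: `run/shared/lean/prim/prim-ineq-gen-7/FINDING-HG-g49.md` §1.

SETTING.  `X` a finite partial order, `ι : X → X` an order-reversing involution, antipodal Kleitman (AK) in the functional form of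
`AntitheticProduct.antipodalKleitman_prod` with unit weights: `0 ≤ ∑ x, f x * (g x − g (ι x))` for all monotone `f, g : X → ℝ`.  A HALF is a
down-set `L` with `x ∈ L ↔ ι x ∉ L`.  The UPPER HALF `X ∖ L` carries the *polarity* `a ~ b :⟺ ι a ≤ b`.
* `AntitheticHalfCone.half_cone` — PROPERTY A OF THE UPPER HALF: for all `u, v : X → ℝ` that are monotone ON `X ∖ L` and *polar-admissible*
  there (`u a + u b ≥ 0` whenever `a, b ∉ L` and `ι a ≤ b`; values on `L` are irrelevant), `0 ≤ ∑_{x ∉ L} u x * v x`.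
  PROOF (memo §1): extend `u` to the ODD function `f x = u x (x ∉ L)`, `f x = −u (ι x) (x ∈ L)`; `f` is monotone on `X` (inside `L` by antitonicity
  of `ι`, across the cut by polar-admissibility, and `X ∖ L` is an up-set); AK applied to the odd extensions gives `0 ≤ ∑ f (g − g∘ι) = 2 ∑ f g
  = 4 ∑_{x ∉ L} u v`.
This is the hypothesis `hA₂` of `AntitheticRowPairing.matchable_product` / `two_rows` for the polarized preorder `(X ∖ L, ≤, ~)`, so THEOREM M
(matchable halves glue) applies to halves of AK posets given in the functional form, e.g. to Boolean lattices (`antipodalKleitman_cube`) and to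
products (`antipodalKleitman_prod`).
-/

namespace Summit.CriticalPhenomena.PercolationContinuityZ3.Theorems

open Finset

namespace AntitheticHalfCone

variable {X : Type*} [Fintype X] [DecidableEq X] [PartialOrder X]

/-- **The half-cone inequality.**  `X` AK (functional form, unit weights), `ι` an order-reversing involution, `L` a half (down-set with
`x ∈ L ↔ ι x ∉ L`).  Then for `u, v : X → ℝ` monotone on the upper half `{x | x ∉ L}` and polar-admissible there
(`a ∉ L → b ∉ L → ι a ≤ b → 0 ≤ u a + u b`, same for `v`): `0 ≤ ∑ x ∈ univ.filter (· ∉ L), u x * v x` — property A of the polarized upper half.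
[this work] -/
theorem half_cone (ι : X → X) (hιι : Function.Involutive ι) (hanti : ∀ x y : X, x ≤ y → ι y ≤ ι x)
    (hAK : ∀ f g : X → ℝ, Monotone f → Monotone g → 0 ≤ ∑ x, f x * (g x - g (ι x)))
    (L : Finset X) (hL : ∀ x, x ∈ L ↔ ι x ∉ L) (hdown : ∀ x y, x ≤ y → y ∈ L → x ∈ L)
    (u v : X → ℝ)
    (hu : ∀ x y, x ∉ L → y ∉ L → x ≤ y → u x ≤ u y) (hv : ∀ x y, x ∉ L → y ∉ L → x ≤ y → v x ≤ v y)
    (hpu : ∀ a b, a ∉ L → b ∉ L → ι a ≤ b → 0 ≤ u a + u b) (hpv : ∀ a b, a ∉ L → b ∉ L → ι a ≤ b → 0 ≤ v a + v b) :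
    0 ≤ ∑ x ∈ univ.filter (fun x => x ∉ L), u x * v x := by
  have hLι : ∀ x, x ∉ L → ι x ∈ L := fun x hx => by
    have h := hL (ι x)
    rw [hιι x] at h
    by_contra h'
    exact hx (by tauto)
  -- odd extensions
  set f : X → ℝ := fun x => if x ∈ L then -u (ι x) else u x with hf_def
  set g : X → ℝ := fun x => if x ∈ L then -v (ι x) else v x with hg_def
  have mono : ∀ (w : X → ℝ), (∀ x y, x ∉ L → y ∉ L → x ≤ y → w x ≤ w y) →
      (∀ a b, a ∉ L → b ∉ L → ι a ≤ b → 0 ≤ w a + w b) →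
      Monotone (fun x => if x ∈ L then -w (ι x) else w x) := by
    intro w hw hpw x y hxy
    by_cases hx : x ∈ L <;> by_cases hy : y ∈ L
    · -- both in L: ι y ≤ ι x, both outside L
      have h1 : ι x ∉ L := (hL x).1 hx
      have h2 : ι y ∉ L := (hL y).1 hy
      have := hw (ι y) (ι x) h2 h1 (hanti x y hxy)
      simp only [hx, hy, if_true]
      linarith
    · -- x ∈ L, y ∉ L: cross relation ι (ι x) = x ≤ y
      have h1 : ι x ∉ L := (hL x).1 hx
      have := hpw (ι x) y h1 hy (by rw [hιι x]; exact hxy)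
      simp only [hx, hy, if_true, if_false]
      linarith
    · exact absurd (hdown x y hxy hy) hx
    · simp only [hx, hy, if_false]
      exact hw x y hx hy hxy
  have hf : Monotone f := mono u hu hpu
  have hg : Monotone g := mono v hv hpv
  have godd : ∀ x, g (ι x) = -g x := by
    intro x
    by_cases hx : x ∈ L
    · have h1 : ι x ∉ L := (hL x).1 hx
      simp only [hg_def, hx, h1, if_true, if_false, neg_neg]
    · have h1 : ι x ∈ L := hLι x hx
      simp only [hg_def, hx, h1, if_true, if_false, hιι x]
  have key := hAK f g hf hg
  have e1 : ∑ x, f x * (g x - g (ι x)) = 2 * ∑ x, f x * g x := by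
    rw [Finset.mul_sum]
    refine Finset.sum_congr rfl (fun x _ => ?_)
    rw [godd x]
    ring
  -- ∑ f g = ∑_{x ∉ L} u v + ∑_{x ∈ L} u (ι x) v (ι x) = 2 ∑_{x ∉ L} u v
  have e2 : ∑ x, f x * g x = ∑ x ∈ univ.filter (fun x => x ∈ L), f x * g x + ∑ x ∈ univ.filter (fun x => x ∉ L), f x * g x :=
    (Finset.sum_filter_add_sum_filter_not _ _ _).symm
  have e3 : ∑ x ∈ univ.filter (fun x => x ∉ L), f x * g x = ∑ x ∈ univ.filter (fun x => x ∉ L), u x * v x := by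
    refine Finset.sum_congr rfl (fun x hx => ?_)
    have hx' : x ∉ L := (Finset.mem_filter.1 hx).2
    simp only [hf_def, hg_def, hx', if_false]
  have e4 : ∑ x ∈ univ.filter (fun x => x ∈ L), f x * g x = ∑ x ∈ univ.filter (fun x => x ∉ L), u x * v x := by
    -- reindex by ι : L → X ∖ L
    refine Finset.sum_nbij' ι ι ?_ ?_ ?_ ?_ ?_
    · intro x hx
      have hx' : x ∈ L := (Finset.mem_filter.1 hx).2
      exact Finset.mem_filter.2 ⟨Finset.mem_univ _, (hL x).1 hx'⟩
    · intro y hy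
      have hy' : y ∉ L := (Finset.mem_filter.1 hy).2
      exact Finset.mem_filter.2 ⟨Finset.mem_univ _, hLι y hy'⟩
    · intro x _; exact hιι x
    · intro y _; exact hιι y
    · intro x hx
      have hx' : x ∈ L := (Finset.mem_filter.1 hx).2
      simp only [hf_def, hg_def, hx', if_true]
      ring
  have e5 : ∑ x, f x * g x = 2 * ∑ x ∈ univ.filter (fun x => x ∉ L), u x * v x := by
    rw [e2, e3, e4]; ring
  rw [e1, e5] at key
  linarith

end AntitheticHalfCone

end Summit.CriticalPhenomena.PercolationContinuityZ3.Theorems
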